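import Literature.Probability.LatticeModels.GaussianDomination
import HarnessLib

/-!
# Gaussian domination, proved: reflection positivity through bonds and the descent on bad bonds

Trunk G02 (T-STATMECH), topic `Probability/LatticeModels`; namespaces `Literature.StatMech` (the
finite-sum reflection-positivity machinery) and `Literature.CritIsing` (the two discharges). Sibling
proof file of `GaussianDomination.lean`, which vendors the named fact
`Literature.Probability.LatticeModels.gaussianDomination` (Friedli–Velenik 2017, Prop. 10.27, eq. (10.43)) and proves the
infrared bound from it (`infraredBound_of_gaussianDomination`). Here the fact is **discharged**,

* `Literature.CritIsing.gaussianDomination_holds : gaussianDomination`, hence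
* `Literature.CritIsing.infraredBound_holds : infraredBound` — the tree's named fact crit-ising.S11
  (`InfraredBound.lean`; Fröhlich–Simon–Spencer, Comm. Math. Phys. **50** (1976), Thm. 3.1;
  Friedli–Velenik 2017, Thm. 10.24) is now a theorem,

following

* S. Friedli, Y. Velenik, *Statistical Mechanics of Lattice Systems*, CUP (2017), §10.3
  (reflections through edges of the torus, (10.1)–(10.2)) and §10.5.3, Lemma 10.28 and the proof
  of Prop. 10.27 (PDF pp. 504–505).

## Proof architecture (all sums are finite: Ising spins on a finite graph)

1. **Lemma 10.28 in finite form** (`expKernel_cauchySchwarz`): for `β ≥ 0`, real weights `Φ, Ψ`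
   on a finite type and real features `p_x, q_x`,
   `(∑_{τ,τ'} Φ(τ)Ψ(τ')e^{β∑_x p_x(τ)q_x(τ')})² ≤ (∑ ΦΦ' e^{β∑pp'})(∑ ΨΨ' e^{β∑qq'})`, by expanding
   the exponential as in (10.44) (`hasSum_expKernel`) and the discriminant argument on
   `∑_n βⁿ/n! ∑_{x⃗}(a_{x⃗} - t b_{x⃗})² ≥ 0`. This replaces the appeal to the reflection positivity
   of the product measure: after the expansion each term is a perfect square.
2. **Splitting `Z(h)` along a reflection** of a finite graph `G` — an involutive automorphism `θ`
   with a "positive half" `P` exchanged with its complement and all edges between the halves of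
   the form `{x, θx}` (`crossSites`, `innerEdges`): with the half exponent `A_g` of the proof of
   Prop. 10.27 (`halfExponent`, `halfWeight`) and the two-field functional `pairSum`,
   `Z(g) = pairSum(g, g∘θ)` (`gaussZ_eq_pairSum`, via `σ ↦ (σ|_P, (σ∘θ)|_P)` and
   `‖ω_i - ω_j + h_i - h_j‖² = ‖ω_i + h_i‖² + ‖ω_j + h_j‖² - 2(ω_i + h_i)(ω_j + h_j)` on crossing
   bonds, `exponent_reflect_split`), and Lemma 10.28 gives
   **`Z(h)² ≤ Z(h⁺) Z(h⁻)`** (`gaussZ_sq_le_reflect`) with `h⁺ = (h on P, h∘θ off P)`,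
   `h⁻ = (h∘θ on P, h off P)` (`reflPlus`, `reflMinus`).
3. **The bond reflections of the even torus** (§10.3): the tree's `Torus.reflectBetweenSites i k`
   (`x_i ↦ 2k + 1 - x_i`) and `Torus.halfBetweenSites i k` (`1 ≤ x_i - k ≤ L/2`) of
   `ReflectionPositivity.lean` satisfy the hypotheses of step 2 for `L` even, `L ≥ 4`
   (`Torus.torusGraph_adj_reflectBetweenSites_iff`, `Torus.mem_halfBetweenSites_iff_reflect_not_mem`,
   `Torus.eq_reflectBetweenSites_of_adj`), and every bond `{x, x + eᵢ}` is bisected by the mirror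
   of `reflectBetweenSites i (x i)` (`Torus.add_single_mem_halfBetweenSites`).
4. **The descent** (proof of Prop. 10.27, p. 505): with `N(g)` the number of bad bonds
   (`badBonds`), `N(g⁺) + N(g⁻) + 2N_C(g) = 2N(g)` where `N_C` counts the bad crossing bonds
   (`badBonds_reflPlus_add_reflMinus`); a maximiser of `Z` with minimal `N` has `N = 0`, and
   `N(g) = 0 ⇒ Z(g) = Z(0)` termwise (`gaussZ_eq_gaussZ_zero_of_badBonds_eq_zero`), whence
   `Z(h) ≤ Z(0)` (`gaussZ_le_gaussZ_zero`).

**Deviation from the printed proof.** Friedli–Velenik normalise `h_0 = 0` and take a maximiser of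
`Z` over all fields (compactness, "`Z_{L;β}(h)` tends to `0` as any `‖h_i‖ → ∞`"). We instead
maximise over the *finite* set of fields taking values in the range of `h`, which contains `h` and
is stable under `g ↦ g^±`; then no topology is needed and the conclusion `Z(h) ≤ Z(g*) = Z(0)` is
the same. (This finite descent is the one of Kennedy–Lieb–Shastry, J. Stat. Phys. 53 (1988),
p. 1029, used in the tree's `XYOrderGDProofs.lean`.)

## Scope

Ising spins (`ν = 1`), nearest-neighbour torus `(ℤ/Lℤ)^d` with `L` even and `L ≠ 2` (so
`L ≥ 4`; the tree's simple `torusGraph d 2` is not the periodic torus), `β ≥ 0`, arbitrary real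
`h` — exactly the hypotheses of the named fact. Steps 1, 2 and 4 (except the last theorem) are
stated for an arbitrary finite graph with a reflection.

## Mathlib status

No reflection positivity or Gaussian domination in Mathlib. Anchors: `NormedSpace.expSeries_div_hasSum_exp`,
`Real.exp_eq_exp_ℝ`, `hasSum_sum`, `discrim_le_zero`,
`Finset.sum_nbij'`, `Fintype.piFinset`, `Finset.exists_max_image`, `Finset.exists_min_image`,
`ZMod.val_intCast`, `ZMod.natCast_zmod_val`, `Sym2.lift`, `SimpleGraph.edgeFinset`.
-/

noncomputable section

open MeasureTheory Filter Topology Finset Complex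
open scoped ComplexConjugate Real

namespace Literature.Probability.LatticeModels

/-! ### A Cauchy–Schwarz inequality for exponential kernels (Friedli–Velenik 2017, Lemma 10.28) -/

section ExpKernel

variable {T C : Type*} [Fintype T] [Fintype C]

/-- `(∑_x f x)^n = ∑_{v : Fin n → C} ∏_m f (v m)`. [folklore] -/
theorem sum_pow_eq_sum_fun (f : C → ℝ) (n : ℕ) :
    (∑ x, f x) ^ n = ∑ v : Fin n → C, ∏ m, f (v m) := by
  rw [← Fintype.prod_sum fun (_ : Fin n) (x : C) => f x, Finset.prod_const, Finset.card_univ,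
    Fintype.card_fin]

/-- The series behind Lemma 10.28: `∑_{τ,τ'} Φ(τ)Ψ(τ') e^{β∑_x p_x(τ)q_x(τ')} =
∑_n βⁿ/n! ∑_{x⃗ ∈ Cⁿ} (∑_τ Φ(τ)∏_m p_{x_m}(τ)) (∑_τ' Ψ(τ')∏_m q_{x_m}(τ'))`
(Friedli–Velenik 2017, proof of Lemma 10.28, (10.44)). [cite: FriedliVelenik2017, Lemma 10.28, eq. (10.44)] -/
theorem hasSum_expKernel (β : ℝ) (Φ Ψ : T → ℝ) (p q : C → T → ℝ) :
    HasSum (fun n : ℕ => β ^ n / (n.factorial : ℝ) *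
      ∑ v : Fin n → C, (∑ τ, Φ τ * ∏ m, p (v m) τ) * (∑ τ', Ψ τ' * ∏ m, q (v m) τ'))
      (∑ τ, ∑ τ', Φ τ * Ψ τ' * Real.exp (β * ∑ x, p x τ * q x τ')) := by
  have hterm : ∀ τ τ', HasSum (fun n : ℕ => Φ τ * Ψ τ' * (β ^ n / (n.factorial : ℝ) *
      ∑ v : Fin n → C, (∏ m, p (v m) τ) * ∏ m, q (v m) τ'))
      (Φ τ * Ψ τ' * Real.exp (β * ∑ x, p x τ * q x τ')) := by
    intro τ τ'
    refine HasSum.mul_left _ ?_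
    have h : HasSum (fun n : ℕ => (β * ∑ x, p x τ * q x τ') ^ n / (n.factorial : ℝ))
        (Real.exp (β * ∑ x, p x τ * q x τ')) := by
      rw [Real.exp_eq_exp_ℝ]
      exact NormedSpace.expSeries_div_hasSum_exp _
    have hfun : (fun n : ℕ => (β * ∑ x, p x τ * q x τ') ^ n / (n.factorial : ℝ)) =
        fun n : ℕ => β ^ n / (n.factorial : ℝ) *
          ∑ v : Fin n → C, (∏ m, p (v m) τ) * ∏ m, q (v m) τ' := by
      funext n
      rw [mul_pow, sum_pow_eq_sum_fun, Finset.mul_sum, Finset.sum_div, Finset.mul_sum]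
      refine Finset.sum_congr rfl fun v _ => ?_
      rw [Finset.prod_mul_distrib]
      ring
    rw [hfun] at h
    exact h
  have hsum := hasSum_sum fun τ (_ : τ ∈ (Finset.univ : Finset T)) =>
    hasSum_sum fun τ' (_ : τ' ∈ (Finset.univ : Finset T)) => hterm τ τ'
  convert hsum using 1
  funext n
  rw [Finset.mul_sum]
  simp_rw [Finset.sum_mul_sum, Finset.mul_sum]
  rw [Finset.sum_comm]
  refine Finset.sum_congr rfl fun τ _ => ?_
  rw [Finset.sum_comm]
  refine Finset.sum_congr rfl fun τ' _ => ?_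
  refine Finset.sum_congr rfl fun v _ => ?_
  ring

/-- **Cauchy–Schwarz for exponential kernels** (the `ν = 1`, finite-configuration form of
Friedli–Velenik 2017, Lemma 10.28: `⟨e^{A+ΘB+∑C_αΘD_α}⟩² ≤ ⟨e^{A+ΘA+∑C_αΘC_α}⟩⟨e^{B+ΘB+∑D_αΘD_α}⟩`):
for `β ≥ 0`, real weights `Φ, Ψ` and real features `p_x, q_x`,
`(∑_{τ,τ'} Φ(τ)Ψ(τ')e^{β∑_x p_x(τ)q_x(τ')})² ≤ (∑ ΦΦ e^{β∑pp})(∑ ΨΨ e^{β∑qq})`. Proof by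
expanding the exponentials ((10.44)) and the nonnegativity of
`∑_n βⁿ/n! ∑_{x⃗}(a_{x⃗} - t b_{x⃗})²` for all `t` (discriminant). [cite: FriedliVelenik2017, Lemma 10.28] -/
theorem expKernel_cauchySchwarz {β : ℝ} (hβ : 0 ≤ β) (Φ Ψ : T → ℝ) (p q : C → T → ℝ) :
    (∑ τ, ∑ τ', Φ τ * Ψ τ' * Real.exp (β * ∑ x, p x τ * q x τ')) ^ 2 ≤
      (∑ τ, ∑ τ', Φ τ * Φ τ' * Real.exp (β * ∑ x, p x τ * p x τ')) *
        (∑ τ, ∑ τ', Ψ τ * Ψ τ' * Real.exp (β * ∑ x, q x τ * q x τ')) := by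
  set a : (n : ℕ) → (Fin n → C) → ℝ := fun n v => ∑ τ, Φ τ * ∏ m, p (v m) τ with ha
  set b : (n : ℕ) → (Fin n → C) → ℝ := fun n v => ∑ τ', Ψ τ' * ∏ m, q (v m) τ' with hb
  set c : ℕ → ℝ := fun n => β ^ n / (n.factorial : ℝ) with hc
  have hc0 : ∀ n, 0 ≤ c n := fun n => by positivity
  have hM := hasSum_expKernel β Φ Ψ p q
  have hA := hasSum_expKernel β Φ Φ p p
  have hB := hasSum_expKernel β Ψ Ψ q q
  set M := ∑ τ, ∑ τ', Φ τ * Ψ τ' * Real.exp (β * ∑ x, p x τ * q x τ')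
  set A := ∑ τ, ∑ τ', Φ τ * Φ τ' * Real.exp (β * ∑ x, p x τ * p x τ')
  set B := ∑ τ, ∑ τ', Ψ τ * Ψ τ' * Real.exp (β * ∑ x, q x τ * q x τ')
  -- the quadratic polynomial `B t² - 2M t + A ≥ 0`
  have hquad : ∀ t : ℝ, 0 ≤ B * (t * t) + (-2 * M) * t + A := by
    intro t
    have h := (hA.sub (hM.mul_left (2 * t))).add (hB.mul_left (t ^ 2))
    have hnn : 0 ≤ A - 2 * t * M + t ^ 2 * B := by
      refine h.nonneg fun n => ?_
      have hv : ∑ v : Fin n → C, a n v * a n v - 2 * t * ∑ v : Fin n → C, a n v * b n v +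
          t ^ 2 * ∑ v : Fin n → C, b n v * b n v = ∑ v : Fin n → C, (a n v - t * b n v) ^ 2 := by
        simp only [Finset.mul_sum, ← Finset.sum_sub_distrib, ← Finset.sum_add_distrib]
        exact Finset.sum_congr rfl fun v _ => by ring
      have key : c n * ∑ v : Fin n → C, a n v * a n v - 2 * t * (c n * ∑ v : Fin n → C, a n v * b n v) +
          t ^ 2 * (c n * ∑ v : Fin n → C, b n v * b n v) =
            c n * ∑ v : Fin n → C, (a n v - t * b n v) ^ 2 := by
        rw [← hv]; ring
      have hgoal : 0 ≤ c n * ∑ v : Fin n → C, (a n v - t * b n v) ^ 2 :=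
        mul_nonneg (hc0 n) (Finset.sum_nonneg fun v _ => sq_nonneg _)
      rw [← key] at hgoal
      simpa only [ha, hb, hc] using hgoal
    nlinarith
  have hd := discrim_le_zero hquad
  rw [discrim] at hd
  nlinarith

end ExpKernel

/-! ### Reflections of a finite graph: halves, inner and crossing edges -/

section Reflection

variable {V : Type*} [Fintype V] [DecidableEq V] (G : SimpleGraph V) [DecidableRel G.Adj]
  (θ : V ≃ V) (P : Finset V)

/-- The crossing sites of the positive half `P`: the `x ∈ P` joined to their mirror image `θx`
(Friedli–Velenik 2017, proof of Prop. 10.27: "the edges `{i',j'}` that cross `Π`, with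
`i' ∈ 𝕋_{L,+}` and `j' = Θ(i')`"). [cite: FriedliVelenik2017, §10.5.3, proof of Prop. 10.27] -/
def crossSites : Finset V := P.filter fun x => G.Adj x (θ x)

/-- The edges inside the positive half `P` (Friedli–Velenik 2017, proof of Prop. 10.27, the sum
"`{i,j} ∈ 𝓔_L : i, j ∈ 𝕋_{L,+}(Θ)`" in the definition of `A`). [cite: FriedliVelenik2017, §10.5.3, proof of Prop. 10.27] -/
def innerEdges : Finset (Sym2 V) := G.edgeFinset.filter fun e => e ∈ P.sym2

/-- The half exponent `A` of Friedli–Velenik 2017, proof of Prop. 10.27 (with `β/2` for `β`,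
`ν = 1`): `-(β/2)[∑_{{x,y} ⊆ P}(τ_x - τ_y + g_x - g_y)² + ∑_{x crossing}(τ_x + g_x)²]`. [cite: FriedliVelenik2017, §10.5.3, proof of Prop. 10.27] -/
def halfExponent (β : ℝ) (g : V → ℝ) (τ : V → ℤˣ) : ℝ :=
  -(β / 2) * (∑ e ∈ innerEdges G P,
      Sym2.lift ⟨fun x y => (spinAt x τ - spinAt y τ + (g x - g y)) ^ 2, fun x y => by ring⟩ e +
    ∑ x ∈ crossSites G θ P, (spinAt x τ + g x) ^ 2)

/-- The half weight `e^{A}` on configurations supported in `P` (spins off `P` frozen to `+1`),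
`0` on the others. [cite: FriedliVelenik2017, §10.5.3, proof of Prop. 10.27] -/
def halfWeight (β : ℝ) (g : V → ℝ) (τ : V → ℤˣ) : ℝ :=
  if ∀ x, x ∉ P → τ x = 1 then Real.exp (halfExponent G θ P β g τ) else 0

/-- The two-field functional `⟨e^{A + Θ(B) + ∑_α C_α Θ(D_α)}⟩` of Friedli–Velenik 2017, Lemma 10.28,
written on pairs of half configurations: `∑_{τ,τ'} e^{A_{g₁}(τ)} e^{A_{g₂}(τ')}
e^{β ∑_{x crossing}(τ_x + g₁(x))(τ'_x + g₂(x))}` (`C_x = √β(τ_x + g₁(x))`,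
`Θ(D_x) = √β(τ'_x + g₂(x))`, with `β/2` for the book's `β`). [cite: FriedliVelenik2017, Lemma 10.28 and proof of Prop. 10.27] -/
def pairSum (β : ℝ) (g₁ g₂ : V → ℝ) : ℝ :=
  ∑ τ : V → ℤˣ, ∑ τ' : V → ℤˣ, halfWeight G θ P β g₁ τ * halfWeight G θ P β g₂ τ' *
    Real.exp (β * ∑ x ∈ crossSites G θ P, (spinAt x τ + g₁ x) * (spinAt x τ' + g₂ x))

/-- The symmetrised fields `h⁺` (`h` on `P`, `h ∘ θ` off `P`) of Friedli–Velenik 2017, proof of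
Prop. 10.27. [cite: FriedliVelenik2017, §10.5.3, proof of Prop. 10.27] -/
def reflPlus (h : V → ℝ) : V → ℝ := fun x => if x ∈ P then h x else h (θ x)

/-- The symmetrised field `h⁻` (`h ∘ θ` on `P`, `h` off `P`) of Friedli–Velenik 2017, proof of
Prop. 10.27. [cite: FriedliVelenik2017, §10.5.3, proof of Prop. 10.27] -/
def reflMinus (h : V → ℝ) : V → ℝ := fun x => if x ∈ P then h (θ x) else h x

variable {G θ P}

omit [Fintype V] [DecidableEq V] in
/-- Crossing sites lie in `P`. [folklore] -/
theorem mem_of_mem_crossSites {x : V} (hx : x ∈ crossSites G θ P) : x ∈ P :=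
  (Finset.mem_filter.1 hx).1

/-- Endpoints of inner edges lie in `P`. [folklore] -/
theorem mem_of_mem_innerEdges {e : Sym2 V} (he : e ∈ innerEdges G P) {z : V} (hz : z ∈ e) :
    z ∈ P :=
  Finset.mem_sym2_iff.1 (Finset.mem_filter.1 he).2 z hz

/-- The half exponent depends on the field only through its values on `P`. [folklore] -/
theorem halfExponent_congr (β : ℝ) {g g' : V → ℝ} (hg : ∀ x ∈ P, g x = g' x) (τ : V → ℤˣ) :
    halfExponent G θ P β g τ = halfExponent G θ P β g' τ := by
  unfold halfExponent
  congr 2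
  · refine Finset.sum_congr rfl fun e he => ?_
    have hmem := fun z => mem_of_mem_innerEdges (G := G) (P := P) he (z := z)
    revert hmem
    induction e using Sym2.ind with
    | _ x y =>
      intro hmem
      simp only [Sym2.lift_mk]
      rw [hg x (hmem x (Sym2.mem_mk_left x y)), hg y (hmem y (Sym2.mem_mk_right x y))]
  · exact Finset.sum_congr rfl fun x hx => by rw [hg x (mem_of_mem_crossSites hx)]

/-- `pairSum` depends on the fields only through their values on `P`. [folklore] -/
theorem pairSum_congr (β : ℝ) {g₁ g₁' g₂ g₂' : V → ℝ} (h₁ : ∀ x ∈ P, g₁ x = g₁' x)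
    (h₂ : ∀ x ∈ P, g₂ x = g₂' x) :
    pairSum G θ P β g₁ g₂ = pairSum G θ P β g₁' g₂' := by
  unfold pairSum halfWeight
  refine Finset.sum_congr rfl fun τ _ => Finset.sum_congr rfl fun τ' _ => ?_
  rw [halfExponent_congr β h₁, halfExponent_congr β h₂,
    Finset.sum_congr rfl fun x hx => by
      rw [h₁ x (mem_of_mem_crossSites hx), h₂ x (mem_of_mem_crossSites hx)]]

/-- **Lemma 10.28 for Ising half configurations**: `pairSum(g₁,g₂)² ≤ pairSum(g₁,g₁) pairSum(g₂,g₂)`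
for `β ≥ 0` (`expKernel_cauchySchwarz`). [cite: FriedliVelenik2017, Lemma 10.28] -/
theorem pairSum_sq_le {β : ℝ} (hβ : 0 ≤ β) (g₁ g₂ : V → ℝ) :
    pairSum G θ P β g₁ g₂ ^ 2 ≤ pairSum G θ P β g₁ g₁ * pairSum G θ P β g₂ g₂ := by
  have h := expKernel_cauchySchwarz (T := V → ℤˣ) (C := ↥(crossSites G θ P)) hβ
    (halfWeight G θ P β g₁) (halfWeight G θ P β g₂)
    (fun x τ => spinAt (x : V) τ + g₁ x) (fun x τ => spinAt (x : V) τ + g₂ x)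
  have hcoe : ∀ (f : V → ℝ), ∑ x : ↥(crossSites G θ P), f x = ∑ x ∈ crossSites G θ P, f x :=
    fun f => Finset.sum_coe_sort _ f
  have e1 : ∀ τ τ' : V → ℤˣ, ∑ x : ↥(crossSites G θ P), (spinAt (x : V) τ + g₁ x) * (spinAt (x : V) τ' + g₂ x) =
      ∑ x ∈ crossSites G θ P, (spinAt x τ + g₁ x) * (spinAt x τ' + g₂ x) :=
    fun τ τ' => hcoe fun x => (spinAt x τ + g₁ x) * (spinAt x τ' + g₂ x)
  have e2 : ∀ τ τ' : V → ℤˣ, ∑ x : ↥(crossSites G θ P), (spinAt (x : V) τ + g₁ x) * (spinAt (x : V) τ' + g₁ x) =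
      ∑ x ∈ crossSites G θ P, (spinAt x τ + g₁ x) * (spinAt x τ' + g₁ x) :=
    fun τ τ' => hcoe fun x => (spinAt x τ + g₁ x) * (spinAt x τ' + g₁ x)
  have e3 : ∀ τ τ' : V → ℤˣ, ∑ x : ↥(crossSites G θ P), (spinAt (x : V) τ + g₂ x) * (spinAt (x : V) τ' + g₂ x) =
      ∑ x ∈ crossSites G θ P, (spinAt x τ + g₂ x) * (spinAt x τ' + g₂ x) :=
    fun τ τ' => hcoe fun x => (spinAt x τ + g₂ x) * (spinAt x τ' + g₂ x)
  simp only [e1, e2, e3] at h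
  exact h

end Reflection

/-! ### The reflection identity `Z(h) = pairSum(h, h∘θ)` and `Z(h)² ≤ Z(h⁺)Z(h⁻)` -/

section ReflectionIdentity

variable {V : Type*} [Fintype V] [DecidableEq V] {G : SimpleGraph V} [DecidableRel G.Adj]
  {θ : V ≃ V} {P : Finset V}

/-- The configuration cut down to the positive half (spins off `P` frozen to `+1`). [folklore] -/
def cutCfg (P : Finset V) (σ : V → ℤˣ) : V → ℤˣ := fun x => if x ∈ P then σ x else 1

omit [Fintype V] in
/-- On `P` the cut configuration is the configuration. [folklore] -/
theorem spinAt_cutCfg_of_mem {P : Finset V} (σ : V → ℤˣ) {x : V} (hx : x ∈ P) :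
    spinAt x (cutCfg P σ) = spinAt x σ := by
  simp [cutCfg, spinAt, hx]

omit [Fintype V] in
/-- The cut configuration is `+1` off `P`. [folklore] -/
theorem cutCfg_of_not_mem {P : Finset V} (σ : V → ℤˣ) {x : V} (hx : x ∉ P) : cutCfg P σ x = 1 := by
  simp [cutCfg, hx]

omit [Fintype V] [DecidableEq V] in
/-- For an involution exchanging `P` and its complement: `x ∉ P → θ x ∈ P`. [folklore] -/
theorem mem_of_not_mem_reflect (hθ : ∀ x, θ (θ x) = x) (hP : ∀ x, x ∈ P ↔ θ x ∉ P) {x : V}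
    (hx : x ∉ P) : θ x ∈ P := by
  by_contra h
  have := (hP (θ x)).not.1 h
  rw [hθ] at this
  exact this hx

/-- **Splitting the edge sum along a reflection**: every edge lies inside `P`, or is the mirror
image of an edge inside `P`, or is a crossing edge `{x, θx}` (Friedli–Velenik 2017, proof of
Prop. 10.27, the decomposition `A + Θ(B) + ∑_{i'} C_{i'}·Θ(D_{i'})`). [cite: FriedliVelenik2017, §10.5.3, proof of Prop. 10.27] -/
theorem sum_edgeFinset_reflect_split (hθ : ∀ x, θ (θ x) = x)
    (hadj : ∀ x y, G.Adj (θ x) (θ y) ↔ G.Adj x y) (hP : ∀ x, x ∈ P ↔ θ x ∉ P)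
    (hcross : ∀ x y, x ∈ P → y ∉ P → G.Adj x y → y = θ x) {M : Type*} [AddCommMonoid M]
    (F : Sym2 V → M) :
    ∑ e ∈ G.edgeFinset, F e =
      ∑ e ∈ innerEdges G P, F e + ∑ e ∈ innerEdges G P, F (Sym2.map θ e) +
        ∑ x ∈ crossSites G θ P, F s(x, θ x) := by
  classical
  have hθinj : Function.Injective θ := θ.injective
  -- edges with both endpoints off `P` are the mirror images of the inner edges
  have hout : (G.edgeFinset.filter fun e => e ∉ P.sym2).filter (fun e => e ∈ Pᶜ.sym2) =
      (innerEdges G P).image (Sym2.map θ) := by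
    ext e
    simp only [Finset.mem_filter, SimpleGraph.mem_edgeFinset, Finset.mem_image, innerEdges]
    constructor
    · rintro ⟨⟨he, hnP⟩, hPc⟩
      induction e using Sym2.ind with
      | _ a b =>
        have hadj' : G.Adj a b := he
        rw [Finset.mem_sym2_iff] at hPc
        have ha : a ∉ P := Finset.mem_compl.1 (hPc a (Sym2.mem_mk_left a b))
        have hb : b ∉ P := Finset.mem_compl.1 (hPc b (Sym2.mem_mk_right a b))
        refine ⟨s(θ a, θ b), ⟨?_, ?_⟩, ?_⟩
        · exact (SimpleGraph.mem_edgeSet G).2 ((hadj a b).2 hadj')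
        · rw [Finset.mem_sym2_iff]
          intro z hz
          rcases Sym2.mem_iff.1 hz with rfl | rfl
          · exact mem_of_not_mem_reflect hθ hP ha
          · exact mem_of_not_mem_reflect hθ hP hb
        · rw [Sym2.map_mk, hθ, hθ]
    · rintro ⟨e', ⟨he', hPe'⟩, rfl⟩
      induction e' using Sym2.ind with
      | _ a b =>
        have hadj' : G.Adj a b := he'
        rw [Finset.mem_sym2_iff] at hPe'
        have ha : a ∈ P := hPe' a (Sym2.mem_mk_left a b)
        have hb : b ∈ P := hPe' b (Sym2.mem_mk_right a b)
        rw [Sym2.map_mk]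
        refine ⟨⟨(SimpleGraph.mem_edgeSet G).2 ((hadj a b).2 hadj'), ?_⟩, ?_⟩
        · rw [Finset.mem_sym2_iff]
          intro h
          exact (hP a).1 ha (h (θ a) (Sym2.mem_mk_left _ _))
        · rw [Finset.mem_sym2_iff]
          intro z hz
          rcases Sym2.mem_iff.1 hz with rfl | rfl
          · exact Finset.mem_compl.2 ((hP a).1 ha)
          · exact Finset.mem_compl.2 ((hP b).1 hb)
  -- edges with exactly one endpoint in `P` are the crossing edges
  have hmix : (G.edgeFinset.filter fun e => e ∉ P.sym2).filter (fun e => e ∉ Pᶜ.sym2) =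
      (crossSites G θ P).image (fun x => s(x, θ x)) := by
    ext e
    simp only [Finset.mem_filter, SimpleGraph.mem_edgeFinset, Finset.mem_image, crossSites]
    constructor
    · rintro ⟨⟨he, hnP⟩, hnPc⟩
      induction e using Sym2.ind with
      | _ a b =>
        have hadj' : G.Adj a b := he
        rw [Finset.mem_sym2_iff] at hnP hnPc
        push Not at hnP hnPc
        by_cases ha : a ∈ P
        · have hb : b ∉ P := by
            intro hb
            obtain ⟨z, hz, hzP⟩ := hnP
            rcases Sym2.mem_iff.1 hz with rfl | rfl
            · exact hzP ha
            · exact hzP hb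
          have hba := hcross a b ha hb hadj'
          subst hba
          exact ⟨a, ⟨ha, hadj'⟩, rfl⟩
        · have hb : b ∈ P := by
            by_contra hb
            obtain ⟨z, hz, hzP⟩ := hnPc
            rcases Sym2.mem_iff.1 hz with rfl | rfl
            · exact hzP (Finset.mem_compl.2 ha)
            · exact hzP (Finset.mem_compl.2 hb)
          have hab := hcross b a hb ha hadj'.symm
          subst hab
          exact ⟨b, ⟨hb, hadj'.symm⟩, Sym2.eq_swap⟩
    · rintro ⟨x, ⟨hxP, hxadj⟩, rfl⟩
      have hθx : θ x ∉ P := (hP x).1 hxP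
      refine ⟨⟨(SimpleGraph.mem_edgeSet G).2 hxadj, ?_⟩, ?_⟩
      · rw [Finset.mem_sym2_iff]
        intro h
        exact hθx (h (θ x) (Sym2.mem_mk_right _ _))
      · rw [Finset.mem_sym2_iff]
        intro h
        exact (Finset.mem_compl.1 (h x (Sym2.mem_mk_left _ _))) hxP
  have hinj₂ : Set.InjOn (fun x => s(x, θ x)) (crossSites G θ P) := by
    intro x hx y hy hxy
    simp only [Sym2.eq_iff] at hxy
    rcases hxy with ⟨h, -⟩ | ⟨h, -⟩
    · exact h
    · exfalso
      have hyP : y ∈ P := mem_of_mem_crossSites hy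
      have hxP : x ∈ P := mem_of_mem_crossSites hx
      rw [h] at hxP
      exact (hP y).1 hyP hxP
  rw [← Finset.sum_filter_add_sum_filter_not G.edgeFinset (fun e => e ∈ P.sym2),
    ← Finset.sum_filter_add_sum_filter_not (G.edgeFinset.filter fun e => e ∉ P.sym2)
      (fun e => e ∈ Pᶜ.sym2), hout, hmix,
    Finset.sum_image (fun e _ e' _ h => Sym2.map.injective hθinj h), Finset.sum_image hinj₂,
    add_assoc]
  rfl

omit [Fintype V] [DecidableEq V] in
/-- `∑_x (u_x - v_x)² = ∑ u² + ∑ v² - 2 ∑ uv`. [folklore] -/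
theorem sum_sub_sq (s : Finset V) (u v : V → ℝ) :
    ∑ x ∈ s, (u x - v x) ^ 2 = ∑ x ∈ s, u x ^ 2 + ∑ x ∈ s, v x ^ 2 - 2 * ∑ x ∈ s, u x * v x := by
  rw [Finset.mul_sum, ← Finset.sum_add_distrib, ← Finset.sum_sub_distrib]
  exact Finset.sum_congr rfl fun x _ => by ring

/-- **The exponent of `Z(h)` split along a reflection**:
`-(β/2)∑_E(σ_x - σ_y + g_x - g_y)² = A_g(σ|_P) + A_{g∘θ}((σ∘θ)|_P) + β∑_{x crossing}(σ_x + g_x)(σ_{θx} + g_{θx})`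
(Friedli–Velenik 2017, proof of Prop. 10.27, using
`‖ω_{i'} - ω_{j'} + h_{i'} - h_{j'}‖² = ‖ω_{i'} + h_{i'}‖² + ‖ω_{j'} + h_{j'}‖² - 2(ω_{i'} + h_{i'})·(ω_{j'} + h_{j'})`). [cite: FriedliVelenik2017, §10.5.3, proof of Prop. 10.27] -/
theorem exponent_reflect_split (hθ : ∀ x, θ (θ x) = x)
    (hadj : ∀ x y, G.Adj (θ x) (θ y) ↔ G.Adj x y) (hP : ∀ x, x ∈ P ↔ θ x ∉ P)
    (hcross : ∀ x y, x ∈ P → y ∉ P → G.Adj x y → y = θ x) (β : ℝ) (g : V → ℝ) (σ : V → ℤˣ) :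
    -(β / 2) * gradForm G (fun x => spinAt x σ + g x) (fun x => spinAt x σ + g x) =
      halfExponent G θ P β g (cutCfg P σ) +
        halfExponent G θ P β (g ∘ θ) (cutCfg P (σ ∘ θ)) +
          β * ∑ x ∈ crossSites G θ P,
            (spinAt x (cutCfg P σ) + g x) * (spinAt x (cutCfg P (σ ∘ θ)) + (g ∘ θ) x) := by
  unfold gradForm halfExponent
  rw [sum_edgeFinset_reflect_split hθ hadj hP hcross]
  -- the three pieces
  have hin : ∑ e ∈ innerEdges G P, Sym2.lift ⟨fun x y =>
      (spinAt x σ + g x - (spinAt y σ + g y)) * (spinAt x σ + g x - (spinAt y σ + g y)),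
        fun x y => by ring⟩ e =
      ∑ e ∈ innerEdges G P, Sym2.lift ⟨fun x y =>
        (spinAt x (cutCfg P σ) - spinAt y (cutCfg P σ) + (g x - g y)) ^ 2, fun x y => by ring⟩ e := by
    refine Finset.sum_congr rfl fun e he => ?_
    have hmem := fun z => mem_of_mem_innerEdges (G := G) (P := P) he (z := z)
    revert hmem
    induction e using Sym2.ind with
    | _ x y =>
      intro hmem
      simp only [Sym2.lift_mk]
      rw [spinAt_cutCfg_of_mem σ (hmem x (Sym2.mem_mk_left x y)),
        spinAt_cutCfg_of_mem σ (hmem y (Sym2.mem_mk_right x y))]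
      ring
  have hout : ∑ e ∈ innerEdges G P, Sym2.lift ⟨fun x y =>
      (spinAt x σ + g x - (spinAt y σ + g y)) * (spinAt x σ + g x - (spinAt y σ + g y)),
        fun x y => by ring⟩ (Sym2.map θ e) =
      ∑ e ∈ innerEdges G P, Sym2.lift ⟨fun x y =>
        (spinAt x (cutCfg P (σ ∘ θ)) - spinAt y (cutCfg P (σ ∘ θ)) + ((g ∘ θ) x - (g ∘ θ) y)) ^ 2,
          fun x y => by ring⟩ e := by
    refine Finset.sum_congr rfl fun e he => ?_
    have hmem := fun z => mem_of_mem_innerEdges (G := G) (P := P) he (z := z)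
    revert hmem
    induction e using Sym2.ind with
    | _ x y =>
      intro hmem
      rw [Sym2.map_mk]
      simp only [Sym2.lift_mk, Function.comp_apply]
      rw [spinAt_cutCfg_of_mem _ (hmem x (Sym2.mem_mk_left x y)),
        spinAt_cutCfg_of_mem _ (hmem y (Sym2.mem_mk_right x y))]
      simp only [spinAt, Function.comp_apply]
      ring
  have hcr : ∑ x ∈ crossSites G θ P, Sym2.lift ⟨fun x y =>
      (spinAt x σ + g x - (spinAt y σ + g y)) * (spinAt x σ + g x - (spinAt y σ + g y)),
        fun x y => by ring⟩ s(x, θ x) =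
      ∑ x ∈ crossSites G θ P, ((spinAt x (cutCfg P σ) + g x) -
        (spinAt x (cutCfg P (σ ∘ θ)) + (g ∘ θ) x)) ^ 2 := by
    refine Finset.sum_congr rfl fun x hx => ?_
    have hxP := mem_of_mem_crossSites hx
    simp only [Sym2.lift_mk, Function.comp_apply]
    rw [spinAt_cutCfg_of_mem _ hxP, spinAt_cutCfg_of_mem _ hxP]
    simp only [spinAt, Function.comp_apply]
    ring
  rw [hin, hout, hcr, sum_sub_sq]
  ring

/-- Recombining two half configurations. [folklore] -/
def mergeCfg (θ : V ≃ V) (P : Finset V) (p : (V → ℤˣ) × (V → ℤˣ)) : V → ℤˣ :=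
  fun x => if x ∈ P then p.1 x else p.2 (θ x)

/-- **`Z(h) = pairSum(h, h ∘ θ)`**: the functional of Gaussian domination in the two-half form of
Friedli–Velenik 2017, Lemma 10.28 / proof of Prop. 10.27 (`σ ↦ (σ|_P, (σ∘θ)|_P)` is a bijection
onto pairs of half configurations, and the exponent splits as in `exponent_reflect_split`). [cite: FriedliVelenik2017, §10.5.3, proof of Prop. 10.27] -/
theorem gaussZ_eq_pairSum (hθ : ∀ x, θ (θ x) = x)
    (hadj : ∀ x y, G.Adj (θ x) (θ y) ↔ G.Adj x y) (hP : ∀ x, x ∈ P ↔ θ x ∉ P)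
    (hcross : ∀ x y, x ∈ P → y ∉ P → G.Adj x y → y = θ x) (β : ℝ) (g : V → ℝ) :
    gaussZ G β g = pairSum G θ P β g (g ∘ θ) := by
  classical
  unfold gaussZ pairSum
  rw [← Finset.sum_product']
  -- restrict to admissible pairs
  set F : (V → ℤˣ) × (V → ℤˣ) → ℝ := fun p => halfWeight G θ P β g p.1 *
    halfWeight G θ P β (g ∘ θ) p.2 *
      Real.exp (β * ∑ x ∈ crossSites G θ P, (spinAt x p.1 + g x) * (spinAt x p.2 + (g ∘ θ) x))
    with hF
  set Adm := ((Finset.univ : Finset (V → ℤˣ)) ×ˢ (Finset.univ : Finset (V → ℤˣ))).filter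
    (fun p => (∀ x, x ∉ P → p.1 x = 1) ∧ (∀ x, x ∉ P → p.2 x = 1)) with hAdm
  have hrestrict : ∑ p ∈ (Finset.univ : Finset (V → ℤˣ)) ×ˢ (Finset.univ : Finset (V → ℤˣ)), F p =
      ∑ p ∈ Adm, F p := by
    rw [hAdm, Finset.sum_filter_of_ne]
    intro p _ hp
    by_contra hcon
    apply hp
    simp only [hF, halfWeight]
    rcases not_and_or.1 hcon with h1 | h2
    · rw [if_neg h1]; ring
    · rw [if_neg h2]; ring
  show ∑ σ, Real.exp (-(β / 2) * gradForm G (fun x => spinAt x σ + g x) fun x => spinAt x σ + g x) =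
    ∑ p ∈ (Finset.univ : Finset (V → ℤˣ)) ×ˢ (Finset.univ : Finset (V → ℤˣ)), F p
  rw [hrestrict]
  symm
  refine Finset.sum_nbij' (mergeCfg θ P) (fun σ => (cutCfg P σ, cutCfg P (σ ∘ θ)))
    (fun p _ => Finset.mem_univ _) (fun σ _ => ?_) (fun p hp => ?_) (fun σ _ => ?_) (fun p hp => ?_)
  · -- the split of a configuration is admissible
    rw [hAdm, Finset.mem_filter]
    exact ⟨Finset.mem_product.2 ⟨Finset.mem_univ _, Finset.mem_univ _⟩,
      fun x hx => cutCfg_of_not_mem _ hx, fun x hx => cutCfg_of_not_mem _ hx⟩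
  · -- split ∘ merge = id on admissible pairs
    obtain ⟨-, h1, h2⟩ := Finset.mem_filter.1 hp
    refine Prod.ext (funext fun x => ?_) (funext fun x => ?_)
    · by_cases hx : x ∈ P
      · simp [cutCfg, mergeCfg, hx]
      · simp [cutCfg, hx, h1 x hx]
    · by_cases hx : x ∈ P
      · have hθx : θ x ∉ P := (hP x).1 hx
        simp [cutCfg, mergeCfg, hx, hθx, hθ]
      · simp [cutCfg, hx, h2 x hx]
  · -- merge ∘ split = id
    funext x
    by_cases hx : x ∈ P
    · simp [mergeCfg, cutCfg, hx]
    · have hθx : θ x ∈ P := mem_of_not_mem_reflect hθ hP hx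
      simp [mergeCfg, cutCfg, hx, hθx, hθ]
  · -- the summands agree
    obtain ⟨-, h1, h2⟩ := Finset.mem_filter.1 hp
    set σ := mergeCfg θ P p with hσ
    have hp1 : cutCfg P σ = p.1 := by
      funext x
      by_cases hx : x ∈ P
      · simp [cutCfg, hσ, mergeCfg, hx]
      · simp [cutCfg, hx, h1 x hx]
    have hp2 : cutCfg P (σ ∘ θ) = p.2 := by
      funext x
      by_cases hx : x ∈ P
      · have hθx : θ x ∉ P := (hP x).1 hx
        simp [cutCfg, hσ, mergeCfg, hx, hθx, hθ]
      · simp [cutCfg, hx, h2 x hx]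
    simp only [hF, halfWeight, if_pos h1, if_pos h2]
    rw [← Real.exp_add, ← Real.exp_add, exponent_reflect_split hθ hadj hP hcross β g σ, hp1, hp2]

/-- **`Z(h)² ≤ Z(h⁺) Z(h⁻)`** (Friedli–Velenik 2017, proof of Prop. 10.27:
"One can thus use Lemma 10.28 to obtain `Z_{L;β}(h*)² ≤ Z_{L;β}(h^{*,+}) Z_{L;β}(h^{*,-})`"), for any
reflection `θ` of a finite graph with positive half `P` (involutive automorphism exchanging `P`
and its complement, crossing edges of the form `{x, θx}`) and `β ≥ 0`. [cite: FriedliVelenik2017, §10.5.3, proof of Prop. 10.27] -/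
theorem gaussZ_sq_le_reflect (hθ : ∀ x, θ (θ x) = x)
    (hadj : ∀ x y, G.Adj (θ x) (θ y) ↔ G.Adj x y) (hP : ∀ x, x ∈ P ↔ θ x ∉ P)
    (hcross : ∀ x y, x ∈ P → y ∉ P → G.Adj x y → y = θ x) {β : ℝ} (hβ : 0 ≤ β) (h : V → ℝ) :
    gaussZ G β h ^ 2 ≤ gaussZ G β (reflPlus θ P h) * gaussZ G β (reflMinus θ P h) := by
  rw [gaussZ_eq_pairSum hθ hadj hP hcross β h, gaussZ_eq_pairSum hθ hadj hP hcross β (reflPlus θ P h),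
    gaussZ_eq_pairSum hθ hadj hP hcross β (reflMinus θ P h)]
  have hplus : pairSum G θ P β (reflPlus θ P h) (reflPlus θ P h ∘ θ) = pairSum G θ P β h h := by
    refine pairSum_congr β (fun x hx => by simp [reflPlus, hx]) (fun x hx => ?_)
    have hθx : θ x ∉ P := (hP x).1 hx
    simp [reflPlus, hθx, hθ]
  have hminus : pairSum G θ P β (reflMinus θ P h) (reflMinus θ P h ∘ θ) =
      pairSum G θ P β (h ∘ θ) (h ∘ θ) := by
    refine pairSum_congr β (fun x hx => by simp [reflMinus, hx]) (fun x hx => ?_)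
    have hθx : θ x ∉ P := (hP x).1 hx
    simp [reflMinus, hθx]
  rw [hplus, hminus]
  exact pairSum_sq_le hβ h (h ∘ θ)

end ReflectionIdentity

/-! ### The bond reflections of the even torus -/

section TorusGeometry

variable {d L : ℕ}

/-- Membership in the positive half-torus `Torus.halfBetweenSites i k` (a condition on the
representative of `x_i - k`) is decidable, so that the half is available as a `Finset`. [folklore] -/
instance Torus.decidableMemHalfBetweenSites [NeZero L] (i : Fin d) (k : ZMod L) :
    DecidablePred (· ∈ Torus.halfBetweenSites (d := d) i k) := fun x => by
  unfold Torus.halfBetweenSites; exact inferInstance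

/-- The `i`-th coordinate of the reflection between sites. [folklore] -/
theorem Torus.reflectBetweenSites_apply_self (i : Fin d) (k : ZMod L) (x : TorusSite d L) :
    Torus.reflectBetweenSites i k x i = 2 * k + 1 - x i := by
  simp

/-- The other coordinates are fixed by the reflection between sites. [folklore] -/
theorem Torus.reflectBetweenSites_apply_of_ne (i : Fin d) (k : ZMod L) (x : TorusSite d L)
    {j : Fin d} (hj : j ≠ i) : Torus.reflectBetweenSites i k x j = x j := by
  simp [hj]

/-- The reflection between sites commutes with the unit translations parallel to the mirror.
[folklore] -/
theorem Torus.reflectBetweenSites_add_single_of_ne (i : Fin d) (k : ZMod L) (x : TorusSite d L)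
    {j : Fin d} (hj : j ≠ i) :
    Torus.reflectBetweenSites i k (x + Pi.single j 1) =
      Torus.reflectBetweenSites i k x + Pi.single j 1 := by
  funext l
  by_cases hl : l = i
  · subst hl
    simp [Ne.symm hj]
  · simp [hl, Pi.add_apply]

/-- The reflection between sites reverses the unit translation across the mirror:
`θ x = θ (x + eᵢ) + eᵢ`. [folklore] -/
theorem Torus.reflectBetweenSites_eq_add_single (i : Fin d) (k : ZMod L) (x : TorusSite d L) :
    Torus.reflectBetweenSites i k x =
      Torus.reflectBetweenSites i k (x + Pi.single i 1) + Pi.single i 1 := by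
  funext l
  by_cases hl : l = i
  · subst hl
    simp only [Torus.reflectBetweenSites_apply, Function.update_self, Pi.add_apply,
      Pi.single_eq_same]
    ring
  · simp [hl, Pi.add_apply]

/-- **The reflection between sites is an automorphism of the torus graph** (Friedli–Velenik 2017,
§10.3, "reflection through edges", (10.1): `Θ` maps `𝕋_L` onto itself preserving nearest
neighbours). [cite: FriedliVelenik2017, §10.3, eq. (10.1) (reflection through edges)] -/
theorem Torus.torusGraph_adj_reflectBetweenSites_iff (i : Fin d) (k : ZMod L)
    (x y : TorusSite d L) :
    (torusGraph d L).Adj (Torus.reflectBetweenSites i k x) (Torus.reflectBetweenSites i k y) ↔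
      (torusGraph d L).Adj x y := by
  set θ := Torus.reflectBetweenSites (d := d) (L := L) i k with hθdef
  have hθθ : ∀ z, θ (θ z) = z := Torus.reflectBetweenSites_involutive i k
  have key : ∀ x y : TorusSite d L, (torusGraph d L).Adj x y → (torusGraph d L).Adj (θ x) (θ y) := by
    intro x y hxy
    rw [torusGraph_adj_iff] at hxy ⊢
    obtain ⟨hne, h⟩ := hxy
    refine ⟨fun h' => hne (θ.injective h'), ?_⟩
    rcases h with ⟨j, rfl⟩ | ⟨j, rfl⟩
    · by_cases hj : j = i
      · subst hj
        exact Or.inr ⟨j, Torus.reflectBetweenSites_eq_add_single j k x⟩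
      · exact Or.inl ⟨j, Torus.reflectBetweenSites_add_single_of_ne i k x hj⟩
    · by_cases hj : j = i
      · subst hj
        exact Or.inl ⟨j, Torus.reflectBetweenSites_eq_add_single j k y⟩
      · exact Or.inr ⟨j, Torus.reflectBetweenSites_add_single_of_ne i k y hj⟩
  refine ⟨fun h => ?_, key x y⟩
  have := key _ _ h
  rwa [hθθ, hθθ] at this

/-- The `i`-th coordinate of the reflected site relative to `k`: `(θx)_i - k = 1 - (x_i - k)`.
[folklore] -/
theorem Torus.reflectBetweenSites_apply_self_sub (i : Fin d) (k : ZMod L) (x : TorusSite d L) :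
    Torus.reflectBetweenSites i k x i - k = 1 - (x i - k) := by
  rw [Torus.reflectBetweenSites_apply_self]; ring

variable [NeZero L]

/-- Integer representative of `1 - t`: `((1 - t).val : ℤ) = (1 - t.val) mod L`. [folklore] -/
theorem ZMod.val_one_sub_eq (t : ZMod L) :
    ((1 - t).val : ℤ) = (1 - (t.val : ℤ)) % L := by
  have : (1 - t : ZMod L) = ((1 - (t.val : ℤ) : ℤ) : ZMod L) := by
    push_cast
    rw [ZMod.natCast_zmod_val]
  rw [this, ZMod.val_intCast]

/-- Integer representative of `t + 1`: `((t + 1).val : ℤ) = (t.val + 1) mod L`. [folklore] -/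
theorem ZMod.val_add_one_eq (t : ZMod L) :
    ((t + 1).val : ℤ) = ((t.val : ℤ) + 1) % L := by
  have : (t + 1 : ZMod L) = (((t.val : ℤ) + 1 : ℤ) : ZMod L) := by
    push_cast
    rw [ZMod.natCast_zmod_val]
  rw [this, ZMod.val_intCast]

/-- Integer representative of `t - 1`: `((t - 1).val : ℤ) = (t.val - 1) mod L`. [folklore] -/
theorem ZMod.val_sub_one_eq (t : ZMod L) :
    ((t - 1).val : ℤ) = ((t.val : ℤ) - 1) % L := by
  have : (t - 1 : ZMod L) = (((t.val : ℤ) - 1 : ℤ) : ZMod L) := by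
    push_cast
    rw [ZMod.natCast_zmod_val]
  rw [this, ZMod.val_intCast]

/-- Membership in the positive half, unfolded. [folklore] -/
theorem Torus.mem_halfBetweenSites_toFinset {i : Fin d} {k : ZMod L} {x : TorusSite d L} :
    x ∈ (Torus.halfBetweenSites i k).toFinset ↔ 1 ≤ (x i - k).val ∧ (x i - k).val ≤ L / 2 := by
  rw [Set.mem_toFinset]; rfl

/-- **For even `L`, the reflection between sites exchanges the positive half-torus and its
complement** (Friedli–Velenik 2017, §10.3, (10.2) and "reflection through edges":
`𝕋_L = 𝕋_{L,+} ∪ 𝕋_{L,-}` "into two disjoint halves", `Θ(𝕋_{L,+}) = 𝕋_{L,-}`; the tree's named fact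
`Torus.reflect_maps_half_compl` in pointwise form). [cite: FriedliVelenik2017, §10.3, eq. (10.2) (reflection through edges)] -/
theorem Torus.mem_halfBetweenSites_iff_reflect_not_mem (hL : Even L) (i : Fin d) (k : ZMod L)
    (x : TorusSite d L) :
    x ∈ (Torus.halfBetweenSites i k).toFinset ↔
      Torus.reflectBetweenSites i k x ∉ (Torus.halfBetweenSites i k).toFinset := by
  obtain ⟨M, hM⟩ := hL
  have hL0 : L ≠ 0 := NeZero.ne L
  rw [Torus.mem_halfBetweenSites_toFinset, Torus.mem_halfBetweenSites_toFinset,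
    Torus.reflectBetweenSites_apply_self_sub]
  set t : ZMod L := x i - k
  have hv := ZMod.val_one_sub_eq (L := L) t
  have hlt : ((t.val : ℕ) : ℤ) < L := by exact_mod_cast ZMod.val_lt t
  have hL2 : (L / 2 : ℕ) = M := by omega
  rw [hL2]
  -- case analysis on the representative `m = t.val`
  set m : ℕ := t.val with hm
  set v : ℕ := (1 - t).val with hvdef
  rcases Nat.lt_or_ge m 2 with hsmall | hbig
  · have hv' : (v : ℤ) = 1 - (m : ℤ) := by
      rw [hv]; exact Int.emod_eq_of_lt (by omega) (by omega)
    omega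
  · have hv' : (v : ℤ) = 1 - (m : ℤ) + L := by
      rw [hv]
      have h1 : (1 - (m : ℤ)) = (1 - (m : ℤ) + L) + L * (-1) := by ring
      conv_lhs => rw [h1, Int.add_mul_emod_self_left]
      exact Int.emod_eq_of_lt (by omega) (by omega)
    omega

/-- **A bond with exactly one endpoint in the positive half is bisected by the mirror**: if
`x ∈ 𝕋_{L,+}`, `y ∉ 𝕋_{L,+}` and `x ∼ y` then `y = Θ x` (Friedli–Velenik 2017, proof of Prop. 10.27:
the edges between the two halves are the `{i, Θ(i)}`, for `L` even). [cite: FriedliVelenik2017, §10.5.3, proof of Prop. 10.27] -/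
theorem Torus.eq_reflectBetweenSites_of_adj (hL : Even L) (hL4 : 4 ≤ L) (i : Fin d) (k : ZMod L)
    {x y : TorusSite d L} (hx : x ∈ (Torus.halfBetweenSites i k).toFinset)
    (hy : y ∉ (Torus.halfBetweenSites i k).toFinset) (hxy : (torusGraph d L).Adj x y) :
    y = Torus.reflectBetweenSites i k x := by
  obtain ⟨M, hM⟩ := hL
  have hL2 : (L / 2 : ℕ) = M := by omega
  rw [Torus.mem_halfBetweenSites_toFinset, hL2] at hx hy
  rw [torusGraph_adj_iff] at hxy
  obtain ⟨hne, h⟩ := hxy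
  -- a translation parallel to the mirror does not change the side
  have hpar : ∀ {j : Fin d}, j ≠ i → ∀ z : TorusSite d L, (z + Pi.single j 1 : TorusSite d L) i = z i := by
    intro j hj z
    simp [Pi.add_apply, hj.symm]
  set t : ZMod L := x i - k with ht
  have hlt : ((t.val : ℕ) : ℤ) < L := by exact_mod_cast ZMod.val_lt t
  have htval : ((t.val : ℕ) : ZMod L) = t := ZMod.natCast_zmod_val t
  rcases h with ⟨j, rfl⟩ | ⟨j, rfl⟩
  · -- `y = x + e_j`
    by_cases hj : j = i
    · subst hj
      have hyi : (x + Pi.single j 1 : TorusSite d L) j - k = t + 1 := by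
        rw [ht, Pi.add_apply, Pi.single_eq_same]; ring
      rw [hyi] at hy
      have hv := ZMod.val_add_one_eq (L := L) t
      -- `t.val = M`
      have htM : t.val = M := by
        by_contra hne'
        have hv' : (((t + 1).val : ℕ) : ℤ) = (t.val : ℤ) + 1 := by
          rw [hv]; exact Int.emod_eq_of_lt (by omega) (by omega)
        omega
      -- hence `x_j = k + M` and `θ x = x + e_j`
      funext l
      by_cases hl : l = j
      · subst hl
        rw [Torus.reflectBetweenSites_apply_self, Pi.add_apply, Pi.single_eq_same]
        have hxl : x l = k + t := by rw [ht]; ring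
        have h2t : t + t = 0 := by
          rw [← htval, htM, ← Nat.cast_add, ← hM, ZMod.natCast_self]
        linear_combination (2 : ZMod L) * hxl + h2t
      · rw [Torus.reflectBetweenSites_apply_of_ne j k x hl, Pi.add_apply, Pi.single_apply,
          if_neg hl, add_zero]
    · exfalso
      apply hy
      rw [hpar hj x]
      exact hx
  · -- `x = y + e_j`
    by_cases hj : j = i
    · subst hj
      have hyi : y j - k = t - 1 := by
        rw [ht, Pi.add_apply, Pi.single_eq_same]; ring
      rw [hyi] at hy
      have hv := ZMod.val_sub_one_eq (L := L) t
      have ht1 : t.val = 1 := by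
        by_contra hne'
        have hv' : (((t - 1).val : ℕ) : ℤ) = (t.val : ℤ) - 1 := by
          rw [hv]; exact Int.emod_eq_of_lt (by omega) (by omega)
        omega
      have ht1' : t = 1 := by rw [← htval, ht1, Nat.cast_one]
      funext l
      by_cases hl : l = j
      · subst hl
        rw [Torus.reflectBetweenSites_apply_self, Pi.add_apply, Pi.single_eq_same]
        have hE : t = y l + 1 - k := by rw [ht, Pi.add_apply, Pi.single_eq_same]
        linear_combination (-2 : ZMod L) * hE + 2 * ht1'
      · rw [Torus.reflectBetweenSites_apply_of_ne j k _ hl, Pi.add_apply, Pi.single_apply,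
          if_neg hl, add_zero]
    · exfalso
      apply hy
      have ht' : t = y i - k := by rw [ht, hpar hj y]
      rw [← ht']
      exact hx

/-- The bond `{x, x + eᵢ}` is bisected by the mirror of `reflectBetweenSites i (x i)`:
`x + eᵢ` lies in the positive half and is reflected onto `x` (for `L ≥ 2`). [folklore] -/
theorem Torus.add_single_mem_halfBetweenSites (hL2 : 2 ≤ L) (i : Fin d) (x : TorusSite d L) :
    x + Pi.single i 1 ∈ (Torus.halfBetweenSites i (x i)).toFinset ∧
      Torus.reflectBetweenSites i (x i) (x + Pi.single i 1) = x := by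
  constructor
  · rw [Torus.mem_halfBetweenSites_toFinset]
    have h1 : (x + Pi.single i 1 : TorusSite d L) i - x i = 1 := by simp
    rw [h1, ZMod.val_one'' (by omega : L ≠ 1)]
    constructor
    · exact le_rfl
    · omega
  · have := Torus.reflectBetweenSites_eq_add_single i (x i) x
    -- `θ x = θ (x + eᵢ) + eᵢ`, and `θ x = x + eᵢ`
    have hθx : Torus.reflectBetweenSites i (x i) x = x + Pi.single i 1 := by
      funext l
      by_cases hl : l = i
      · subst hl; simp; ring
      · simp [hl, Pi.add_apply]
    rw [hθx] at this
    exact (add_right_cancel this).symm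

end TorusGeometry

/-! ### Gaussian domination by descent on the number of bad bonds -/

section Descent

variable {V : Type*} [Fintype V] [DecidableEq V] {G : SimpleGraph V} [DecidableRel G.Adj]

/-- The bad-bond indicator of a field `g` on an unordered pair: `1` if `g x ≠ g y`, else `0`.
[cite: FriedliVelenik2017, §10.5.3, proof of Prop. 10.27] -/
def badInd (g : V → ℝ) : Sym2 V → ℕ :=
  Sym2.lift ⟨fun x y => if g x = g y then (0 : ℕ) else 1, fun x y => by
    by_cases h : g x = g y <;> simp [h, eq_comm]⟩

/-- The number of *bad bonds* of a field `g`: edges `{x, y}` with `g x ≠ g y`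
(Friedli–Velenik 2017, proof of Prop. 10.27: "`N(h)` the number of edges `{i,j}` with
`h_i ≠ h_j`"). [cite: FriedliVelenik2017, §10.5.3, proof of Prop. 10.27] -/
def badBonds (G : SimpleGraph V) [DecidableRel G.Adj] (g : V → ℝ) : ℕ :=
  ∑ e ∈ G.edgeFinset, badInd g e

omit [Fintype V] [DecidableEq V] in
/-- Value of the bad-bond indicator on `s(x, y)`. [folklore] -/
@[simp] theorem badInd_mk (g : V → ℝ) (x y : V) :
    badInd g s(x, y) = if g x = g y then 0 else 1 := rfl

/-- A field without bad bonds does not change `Z`: `N(g) = 0 ⇒ Z(g) = Z(0)` (each bond term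
`(σ_x - σ_y + g_x - g_y)²` equals `(σ_x - σ_y)²`; Friedli–Velenik 2017, proof of Prop. 10.27:
"If `N(h*) = 0`, then `h*_i = h*_j` for all `{i,j}`, so `Z(h*) = Z(0)`"). [cite: FriedliVelenik2017, §10.5.3, proof of Prop. 10.27] -/
theorem gaussZ_eq_gaussZ_zero_of_badBonds_eq_zero (β : ℝ) {g : V → ℝ} (hg : badBonds G g = 0) :
    gaussZ G β g = gaussZ G β 0 := by
  unfold gaussZ
  refine Finset.sum_congr rfl fun σ _ => ?_
  congr 1
  congr 1
  unfold gradForm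
  refine Finset.sum_congr rfl fun e he => ?_
  have hterm := (Finset.sum_eq_zero_iff.1 hg) e he
  induction e using Sym2.ind with
  | _ x y =>
    rw [badInd_mk] at hterm
    have hxy : g x = g y := by
      by_contra h
      rw [if_neg h] at hterm
      exact one_ne_zero hterm
    simp only [gradForm_term_mk, Pi.zero_apply, hxy]
    ring

/-- `Z > 0`. [folklore] -/
theorem gaussZ_pos (β : ℝ) (g : V → ℝ) : 0 < gaussZ G β g := by
  unfold gaussZ
  exact Finset.sum_pos (fun σ _ => Real.exp_pos _) Finset.univ_nonempty

variable {θ : V ≃ V} {P : Finset V}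

/-- **The bad-bond count of the symmetrised fields** (Friedli–Velenik 2017, proof of Prop. 10.27:
"`N(h^{*,+}) + N(h^{*,-}) ≤ 2N(h*) - 2 < 2N(h*)`" when a bad bond crosses the mirror; here the exact
identity `N(h⁺) + N(h⁻) + 2N_C(h) = 2N(h)` with `N_C` the number of bad crossing bonds). [cite: FriedliVelenik2017, §10.5.3, proof of Prop. 10.27] -/
theorem badBonds_reflPlus_add_reflMinus (hθ : ∀ x, θ (θ x) = x)
    (hadj : ∀ x y, G.Adj (θ x) (θ y) ↔ G.Adj x y) (hP : ∀ x, x ∈ P ↔ θ x ∉ P)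
    (hcross : ∀ x y, x ∈ P → y ∉ P → G.Adj x y → y = θ x) (g : V → ℝ) :
    badBonds G (reflPlus θ P g) + badBonds G (reflMinus θ P g) +
        2 * ∑ x ∈ crossSites G θ P, badInd g s(x, θ x) =
      2 * badBonds G g := by
  unfold badBonds
  rw [sum_edgeFinset_reflect_split hθ hadj hP hcross (badInd (reflPlus θ P g)),
    sum_edgeFinset_reflect_split hθ hadj hP hcross (badInd (reflMinus θ P g)),
    sum_edgeFinset_reflect_split hθ hadj hP hcross (badInd g)]
  -- evaluate the six partial sums
  have hinP : ∑ e ∈ innerEdges G P, badInd (reflPlus θ P g) e = ∑ e ∈ innerEdges G P, badInd g e := by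
    refine Finset.sum_congr rfl fun e he => ?_
    induction e using Sym2.ind with
    | _ a b =>
      have ha : a ∈ P := mem_of_mem_innerEdges he (Sym2.mem_mk_left a b)
      have hb : b ∈ P := mem_of_mem_innerEdges he (Sym2.mem_mk_right a b)
      simp [reflPlus, ha, hb]
  have houtP : ∑ e ∈ innerEdges G P, badInd (reflPlus θ P g) (Sym2.map θ e) =
      ∑ e ∈ innerEdges G P, badInd g e := by
    refine Finset.sum_congr rfl fun e he => ?_
    induction e using Sym2.ind with
    | _ a b =>
      have ha : θ a ∉ P := (hP a).1 (mem_of_mem_innerEdges he (Sym2.mem_mk_left a b))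
      have hb : θ b ∉ P := (hP b).1 (mem_of_mem_innerEdges he (Sym2.mem_mk_right a b))
      simp [reflPlus, ha, hb, hθ]
  have hcrP : ∑ x ∈ crossSites G θ P, badInd (reflPlus θ P g) s(x, θ x) = 0 := by
    refine Finset.sum_eq_zero fun x hx => ?_
    have hxP : x ∈ P := mem_of_mem_crossSites hx
    have hθx : θ x ∉ P := (hP x).1 hxP
    simp [reflPlus, hxP, hθx, hθ]
  have hinM : ∑ e ∈ innerEdges G P, badInd (reflMinus θ P g) e =
      ∑ e ∈ innerEdges G P, badInd g (Sym2.map θ e) := by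
    refine Finset.sum_congr rfl fun e he => ?_
    induction e using Sym2.ind with
    | _ a b =>
      have ha : a ∈ P := mem_of_mem_innerEdges he (Sym2.mem_mk_left a b)
      have hb : b ∈ P := mem_of_mem_innerEdges he (Sym2.mem_mk_right a b)
      simp [reflMinus, ha, hb]
  have houtM : ∑ e ∈ innerEdges G P, badInd (reflMinus θ P g) (Sym2.map θ e) =
      ∑ e ∈ innerEdges G P, badInd g (Sym2.map θ e) := by
    refine Finset.sum_congr rfl fun e he => ?_
    induction e using Sym2.ind with
    | _ a b =>
      have ha : θ a ∉ P := (hP a).1 (mem_of_mem_innerEdges he (Sym2.mem_mk_left a b))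
      have hb : θ b ∉ P := (hP b).1 (mem_of_mem_innerEdges he (Sym2.mem_mk_right a b))
      simp [reflMinus, ha, hb]
  have hcrM : ∑ x ∈ crossSites G θ P, badInd (reflMinus θ P g) s(x, θ x) = 0 := by
    refine Finset.sum_eq_zero fun x hx => ?_
    have hxP : x ∈ P := mem_of_mem_crossSites hx
    have hθx : θ x ∉ P := (hP x).1 hxP
    simp [reflMinus, hxP, hθx]
  rw [hinP, houtP, hcrP, hinM, houtM, hcrM]
  ring

/-- The symmetrised fields take values among the values of the field. [folklore] -/
theorem reflPlus_mem_piFinset {R : Finset ℝ} {g : V → ℝ} (hg : g ∈ Fintype.piFinset fun _ => R) :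
    reflPlus θ P g ∈ Fintype.piFinset fun _ => R := by
  rw [Fintype.mem_piFinset] at hg ⊢
  intro x
  unfold reflPlus
  split_ifs
  · exact hg x
  · exact hg (θ x)

/-- The symmetrised fields take values among the values of the field. [folklore] -/
theorem reflMinus_mem_piFinset {R : Finset ℝ} {g : V → ℝ} (hg : g ∈ Fintype.piFinset fun _ => R) :
    reflMinus θ P g ∈ Fintype.piFinset fun _ => R := by
  rw [Fintype.mem_piFinset] at hg ⊢
  intro x
  unfold reflMinus
  split_ifs
  · exact hg (θ x)
  · exact hg x

end Descent

section TorusDescent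

variable {d L : ℕ} [NeZero L]

/-- **Gaussian domination on the even torus** (Friedli–Velenik 2017, Prop. 10.27, eq. (10.43)),
by the printed descent (proof of Prop. 10.27, p. 505) run on the finite set of fields taking
values in the range of `h` (so that a maximiser trivially exists): among the maximisers `g` of `Z`
on this set choose one with the fewest bad bonds; if a bond `{x, x + eᵢ}` were bad, the reflection
between sites bisecting it would give `Z(g)² ≤ Z(g⁺)Z(g⁻)` (`gaussZ_sq_le_reflect`), so `g⁺, g⁻`
are again maximisers, while `N(g⁺) + N(g⁻) ≤ 2N(g) - 2` — a contradiction; hence `N(g) = 0` and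
`Z(h) ≤ Z(g) = Z(0)`. Hypotheses: `L` even, `L ≥ 4`, `β ≥ 0`. [cite: FriedliVelenik2017, Prop. 10.27, eq. (10.43)] -/
theorem gaussZ_le_gaussZ_zero (hL : Even L) (hL4 : 4 ≤ L) {β : ℝ} (hβ : 0 ≤ β)
    (h : TorusSite d L → ℝ) :
    gaussZ (torusGraph d L) β h ≤ gaussZ (torusGraph d L) β 0 := by
  classical
  set Gr := torusGraph d L
  -- the finite set of fields with values in the range of `h`
  set R : Finset ℝ := Finset.univ.image h with hR
  set F : Finset (TorusSite d L → ℝ) := Fintype.piFinset fun _ => R with hF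
  have hhF : h ∈ F := by
    rw [hF, Fintype.mem_piFinset]
    intro x
    exact Finset.mem_image_of_mem h (Finset.mem_univ x)
  have hFne : F.Nonempty := ⟨h, hhF⟩
  -- a maximiser of `Z` on `F`
  obtain ⟨g₀, hg₀F, hg₀max⟩ := Finset.exists_max_image F (gaussZ Gr β) hFne
  set Fmax := F.filter fun g => gaussZ Gr β g = gaussZ Gr β g₀ with hFmax
  have hFmaxne : Fmax.Nonempty := ⟨g₀, by simp [hFmax, hg₀F]⟩
  -- among the maximisers, one with the fewest bad bonds
  obtain ⟨g, hgFmax, hgmin⟩ := Finset.exists_min_image Fmax (badBonds Gr) hFmaxne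
  obtain ⟨hgF, hgZ⟩ := Finset.mem_filter.1 hgFmax
  have hgmax : ∀ g' ∈ F, gaussZ Gr β g' ≤ gaussZ Gr β g := fun g' hg' => hgZ ▸ hg₀max g' hg'
  -- claim: `g` has no bad bond
  have hN : badBonds Gr g = 0 := by
    by_contra hN0
    -- a bad bond `{x, x + eᵢ}`
    obtain ⟨e, he, hbad⟩ : ∃ e ∈ Gr.edgeFinset, badInd g e ≠ 0 := by
      by_contra hall
      push Not at hall
      exact hN0 (Finset.sum_eq_zero hall)
    have hL3 : 3 ≤ L := by omega
    obtain ⟨x, i, hxy⟩ : ∃ (x : TorusSite d L) (i : Fin d), e = s(x, x + Pi.single i 1) := by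
      induction e using Sym2.ind with
      | _ a b =>
        have hab : Gr.Adj a b := (SimpleGraph.mem_edgeFinset.1 he)
        rw [torusGraph_adj_iff] at hab
        rcases hab.2 with ⟨i, rfl⟩ | ⟨i, rfl⟩
        · exact ⟨a, i, rfl⟩
        · exact ⟨b, i, Sym2.eq_swap⟩
    subst hxy
    rw [badInd_mk] at hbad
    have hgx : g x ≠ g (x + Pi.single i 1) := by
      intro h'; rw [if_pos h'] at hbad; exact hbad rfl
    -- the reflection bisecting this bond
    set θ := Torus.reflectBetweenSites (d := d) (L := L) i (x i) with hθdef
    set P := (Torus.halfBetweenSites (d := d) (L := L) i (x i)).toFinset with hPdef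
    have hθθ : ∀ z, θ (θ z) = z := Torus.reflectBetweenSites_involutive i (x i)
    have hadj : ∀ a b, Gr.Adj (θ a) (θ b) ↔ Gr.Adj a b :=
      Torus.torusGraph_adj_reflectBetweenSites_iff i (x i)
    have hP : ∀ a, a ∈ P ↔ θ a ∉ P :=
      Torus.mem_halfBetweenSites_iff_reflect_not_mem hL i (x i)
    have hcross : ∀ a b, a ∈ P → b ∉ P → Gr.Adj a b → b = θ a := fun a b ha hb hab =>
      Torus.eq_reflectBetweenSites_of_adj hL hL4 i (x i) ha hb hab
    obtain ⟨hyP, hθy⟩ := Torus.add_single_mem_halfBetweenSites (by omega : 2 ≤ L) i x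
    -- `Z(g)² ≤ Z(g⁺) Z(g⁻)` and both are at most `Z(g)`, so both equal `Z(g)`
    have hsq := gaussZ_sq_le_reflect (G := Gr) hθθ hadj hP hcross hβ g
    have hPF : reflPlus θ P g ∈ F := reflPlus_mem_piFinset hgF
    have hMF : reflMinus θ P g ∈ F := reflMinus_mem_piFinset hgF
    have hPle := hgmax _ hPF
    have hMle := hgmax _ hMF
    have hZpos := gaussZ_pos (G := Gr) β g
    have hPpos := gaussZ_pos (G := Gr) β (reflPlus θ P g)
    have hMpos := gaussZ_pos (G := Gr) β (reflMinus θ P g)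
    have hPeq : gaussZ Gr β (reflPlus θ P g) = gaussZ Gr β g := by
      refine le_antisymm hPle ?_
      by_contra hlt
      push Not at hlt
      have : gaussZ Gr β (reflPlus θ P g) * gaussZ Gr β (reflMinus θ P g) <
          gaussZ Gr β g * gaussZ Gr β g :=
        mul_lt_mul hlt hMle hMpos hZpos.le
      nlinarith
    have hMeq : gaussZ Gr β (reflMinus θ P g) = gaussZ Gr β g := by
      refine le_antisymm hMle ?_
      by_contra hlt
      push Not at hlt
      have : gaussZ Gr β (reflPlus θ P g) * gaussZ Gr β (reflMinus θ P g) <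
          gaussZ Gr β g * gaussZ Gr β g :=
        mul_lt_mul' hPle hlt hMpos.le hZpos
      nlinarith
    -- so `g⁺, g⁻` are maximisers, and minimality of `N(g)` gives `N(g) ≤ N(g±)`
    have hPmin : badBonds Gr g ≤ badBonds Gr (reflPlus θ P g) :=
      hgmin _ (Finset.mem_filter.2 ⟨hPF, hPeq.trans hgZ⟩)
    have hMmin : badBonds Gr g ≤ badBonds Gr (reflMinus θ P g) :=
      hgmin _ (Finset.mem_filter.2 ⟨hMF, hMeq.trans hgZ⟩)
    -- but the bisected bad bond is a crossing bond: `N(g⁺) + N(g⁻) ≤ 2N(g) - 2`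
    have hcount := badBonds_reflPlus_add_reflMinus (G := Gr) hθθ hadj hP hcross g
    have hycross : x + Pi.single i 1 ∈ crossSites Gr θ P := by
      refine Finset.mem_filter.2 ⟨hyP, ?_⟩
      rw [hθy]
      exact (torusGraph_adj_add_single (by omega) x i).symm
    have hone : (1 : ℕ) ≤ ∑ z ∈ crossSites Gr θ P, badInd g s(z, θ z) := by
      calc (1 : ℕ) = badInd g s(x + Pi.single i 1, θ (x + Pi.single i 1)) := by
            rw [badInd_mk, hθy, if_neg (Ne.symm hgx)]
        _ ≤ ∑ z ∈ crossSites Gr θ P, badInd g s(z, θ z) :=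
          Finset.single_le_sum (f := fun z => badInd g s(z, θ z)) (fun z _ => Nat.zero_le _) hycross
    omega
  calc gaussZ Gr β h ≤ gaussZ Gr β g := hgmax h hhF
    _ = gaussZ Gr β 0 := gaussZ_eq_gaussZ_zero_of_badBonds_eq_zero β hN

end TorusDescent

end Literature.Probability.LatticeModels

namespace Literature.Probability.LatticeModels

open Percolation

variable {d L : ℕ} [NeZero L]

/-- **Gaussian domination, proved** (Friedli–Velenik 2017, Prop. 10.27, eq. (10.43)): the named
fact `gaussianDomination` holds — reflection positivity through bond-bisecting planes in the
finite-sum form `gaussZ_sq_le_reflect` (Lemma 10.28 via the exponential series and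
Cauchy–Schwarz) and the descent on the number of bad bonds (`gaussZ_le_gaussZ_zero`). [cite: FriedliVelenik2017, Prop. 10.27, eq. (10.43)] -/
theorem gaussianDomination_holds : gaussianDomination (d := d) (L := L) := by
  intro hL hL2 β hβ h
  have hL0 : L ≠ 0 := NeZero.ne L
  have hL4 : 4 ≤ L := by
    obtain ⟨m, hm⟩ := hL
    omega
  exact gaussZ_le_gaussZ_zero hL hL4 hβ h

/-- **The infrared bound, proved** (Fröhlich–Simon–Spencer, CMP 50 (1976), Thm. 3.1;
Friedli–Velenik 2017, Thm. 10.24): the tree's named fact `infraredBound` (crit-ising.S11) holds,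
from `gaussianDomination_holds` by `infraredBound_of_gaussianDomination`. [cite: FriedliVelenik2017, Thm. 10.24] -/
theorem infraredBound_holds : infraredBound (d := d) (L := L) :=
  infraredBound_of_gaussianDomination gaussianDomination_holds

end Literature.Probability.LatticeModels
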